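import Summits.FinalStateConjecture.FinalStateConjecture.Theorems.EIHFluxBalanceInertialRecessionLabVelocity

/-!
# Route EIHFluxBalance — `InertialRecession`, re-charting: kinematic glue (rates of the painted
# 4-velocity → rates of the lab velocity; velocity convergence and slaving ⇒ package inputs)

Helper file for the crux `stmt-FinalStateConjecture-10166`
(`Summit.FinalStateConjecture.FinalStateConjecture.Theses.EIHFluxBalance.InertialRecession`),
stub `stub_rechart` (the transfer P2 of line `sublinear-is-free-clean-window-charges`).

The `a = 0` re-charting packages consume the lab velocity `v = ũ/u⁰` of the painted 4-velocity
`u = Λe₀` of each hole together with: `v⁽ˡ⁾ → 0` (`l = 1, 2, 3`), `ξ⁽²⁾, ξ⁽³⁾ → 0`, `v → V`,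
`ξ̇ → V`, eventual bounds. This file derives them from the third-order SLAVING clause of the
line's skeleton (`u⁽ˡ⁾ → 0`, `l = 1, 2, 3`; the mismatch `ξ̇ − v` and its first two derivatives
`→ 0`) plus VELOCITY CONVERGENCE `ξ̇ → V` (an extra hypothesis of the re-charting theorem:
Cesàro velocities and slaving alone do not give it — sparse ever wider velocity bumps):

* `exists_smallDeriv_labVelocity` — Faà di Bruno: if `‖u⁽ⁱ⁾(t)‖ ≤ dⁱ` (`1 ≤ i ≤ 3`, `d ≤ 1`) then
  `‖v⁽ˡ⁾(t)‖ ≤ C d` (`G(u) = ũ/u⁰` has bounded derivatives on `{1 ≤ u⁰, ‖u‖ ≤ C_u}`);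
* `tendsto_iteratedDeriv_labVelocity` — hence `u⁽ⁱ⁾ → 0` (`i ≤ 3`) gives `v⁽ˡ⁾ → 0` (`l ≤ 3`);
* `tendsto_iteratedDeriv_centre` — `ξ⁽²⁾ = (ξ̇ − v)′ + v′ → 0`, `ξ⁽³⁾ = (ξ̇ − v)″ + v″ → 0`;
* `eventually_norm_iteratedDeriv_le` — a function tending to a limit is eventually bounded.

[folklore]
-/

noncomputable section

set_option linter.dupNamespace false

open scoped Topology ContDiff
open Filter Set Metric Function Literature.Geometry.Lorentzian

namespace Summit.FinalStateConjecture.FinalStateConjecture.Theorems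

-- operator/vector-valued multilinear maps: the instance path is slow
set_option synthInstance.maxHeartbeats 200000 in
/-- **Small rates of the 4-velocity give small rates of the lab velocity.** For every size `C_u`
there is `C ≥ 0` such that for every `C³` path `w : ℝ → E4` with `1 ≤ w⁰`, `‖w‖ ≤ C_u`, and
`‖w⁽ⁱ⁾(t)‖ ≤ dⁱ` for `1 ≤ i ≤ 3` (`0 ≤ d ≤ 1`): `‖(G ∘ w)⁽ˡ⁾(t)‖ ≤ C d` for `1 ≤ l ≤ 3`,
`G(u) = (u⁰)⁻¹ũ`. [folklore] -/
theorem exists_smallDeriv_labVelocity (Cu : ℝ) :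
    ∃ C : ℝ, 0 ≤ C ∧ ∀ (w : ℝ → E4) (t d : ℝ), ContDiff ℝ 3 w → (∀ s, 1 ≤ w s 0) →
      (∀ s, ‖w s‖ ≤ Cu) → 0 ≤ d → d ≤ 1 →
      (∀ i, 1 ≤ i → i ≤ 3 → ‖iteratedDeriv i w t‖ ≤ d ^ i) →
      ∀ l, 1 ≤ l → l ≤ 3 → ‖iteratedDeriv l (fun s ↦ ((w s) 0)⁻¹ • E4.spatial (w s)) t‖ ≤ C * d := by
  set G : E4 → E3 := fun u ↦ (u 0)⁻¹ • E4.spatial u with hG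
  set O : Set E4 := {u | 1 / 2 < u 0} with hO
  have hc0 : Continuous fun u : E4 ↦ u 0 := PiLp.continuous_apply 2 _ 0
  have hOo : IsOpen O := isOpen_lt continuous_const hc0
  have hGc : ContDiffOn ℝ ∞ G O := fun u hu ↦
    (contDiffAt_labVelocityMap (by change 1 / 2 < u 0 at hu; linarith)).contDiffWithinAt
  set K : Set E4 := {u | 1 ≤ u 0} ∩ closedBall 0 Cu with hK
  have hKc : IsCompact K :=
    (isCompact_closedBall _ _).inter_left (isClosed_le continuous_const hc0)
  have hKO : K ⊆ O := fun u hu ↦ by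
    change 1 / 2 < u 0
    have : 1 ≤ u 0 := hu.1
    linarith
  have hbound : ∀ i : ℕ, ∃ B : ℝ, ∀ u ∈ K, ‖iteratedFDeriv ℝ i G u‖ ≤ B := by
    intro i
    have h1 := hGc.continuousOn_iteratedFDerivWithin (m := i) (by exact_mod_cast le_top)
      hOo.uniqueDiffOn
    have h2 := h1.congr (g := iteratedFDeriv ℝ i G)
      fun p hp ↦ (iteratedFDerivWithin_of_isOpen i hOo hp).symm
    obtain ⟨B, hB⟩ := hKc.exists_bound_of_continuousOn (h2.mono hKO)
    exact ⟨B, hB⟩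
  choose B hB using hbound
  set Bmax : ℝ := ∑ i ∈ Finset.range 4, |B i| with hBmax
  have hBmax0 : 0 ≤ Bmax := Finset.sum_nonneg fun _ _ ↦ abs_nonneg _
  have hBi : ∀ i ≤ 3, ∀ u ∈ K, ‖iteratedFDeriv ℝ i G u‖ ≤ Bmax :=
    fun i hi u hu ↦ ((hB i u hu).trans (le_abs_self _)).trans
      (Finset.single_le_sum (f := fun i ↦ |B i|) (fun _ _ ↦ abs_nonneg _)
        (Finset.mem_range.mpr (by omega)))
  refine ⟨6 * Bmax, by positivity, fun w t d hw hw1 hwC hd0 hd1 hwb l hl1 hl3 ↦ ?_⟩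
  have hwt : w t ∈ K := ⟨hw1 t, by simpa using hwC t⟩
  set s : Set ℝ := w ⁻¹' O with hs
  have hso : IsOpen s := hOo.preimage hw.continuous
  have hts : t ∈ s := hKO hwt
  have hcomp := norm_iteratedFDerivWithin_comp_le (g := G) (f := w) (n := l)
    (N := ((3 : ℕ∞) : WithTop ℕ∞)) (x := t) (hGc.of_le (by exact_mod_cast le_top)) hw.contDiffOn
    (by exact_mod_cast hl3) hOo.uniqueDiffOn hso.uniqueDiffOn (fun y hy ↦ hy) hts (C := Bmax) (D := d)
    (fun i hi ↦ by
      rw [iteratedFDerivWithin_of_isOpen i hOo (hKO hwt)]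
      exact hBi i (hi.trans hl3) (w t) hwt)
    (fun i hi1 hij ↦ by
      rw [iteratedFDerivWithin_of_isOpen i hso hts, norm_iteratedFDeriv_eq_norm_iteratedDeriv]
      exact hwb i hi1 (hij.trans hl3))
  rw [iteratedFDerivWithin_of_isOpen l hso hts] at hcomp
  rw [← norm_iteratedFDeriv_eq_norm_iteratedDeriv]
  refine hcomp.trans ?_
  have h1 : (l.factorial : ℝ) ≤ 6 := by
    interval_cases l <;> norm_num [Nat.factorial]
  have h2 : d ^ l ≤ d := by
    obtain ⟨k, rfl⟩ := Nat.exists_eq_add_of_le' hl1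
    rw [pow_succ]
    exact mul_le_of_le_one_left hd0 (pow_le_one₀ hd0 hd1)
  calc (l.factorial : ℝ) * Bmax * d ^ l ≤ 6 * Bmax * d :=
        mul_le_mul (mul_le_mul_of_nonneg_right h1 hBmax0) h2 (pow_nonneg hd0 l) (by positivity)
    _ = 6 * Bmax * d := rfl

/-- **Vanishing rates of the 4-velocity give vanishing rates of the lab velocity.** If
`w : ℝ → E4` is `C³` with `1 ≤ w⁰`, `‖w‖ ≤ C_u`, and `w⁽ⁱ⁾ → 0` for `i = 1, 2, 3`, then
`(G ∘ w)⁽ˡ⁾ → 0` for `l = 1, 2, 3`. [folklore] -/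
theorem tendsto_iteratedDeriv_labVelocity {w : ℝ → E4} {Cu : ℝ} (hw : ContDiff ℝ 3 w)
    (hw1 : ∀ s, 1 ≤ w s 0) (hwC : ∀ s, ‖w s‖ ≤ Cu)
    (h0 : ∀ i, 1 ≤ i → i ≤ 3 → Tendsto (fun t ↦ iteratedDeriv i w t) atTop (𝓝 0))
    (l : ℕ) (hl1 : 1 ≤ l) (hl3 : l ≤ 3) :
    Tendsto (fun t ↦ iteratedDeriv l (fun s ↦ ((w s) 0)⁻¹ • E4.spatial (w s)) t) atTop (𝓝 0) := by
  obtain ⟨C, hC0, hC⟩ := exists_smallDeriv_labVelocity Cu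
  rw [Metric.tendsto_atTop]
  intro ε hε
  set d : ℝ := min 1 (ε / (C + 1)) with hd
  have hd0 : 0 < d := lt_min one_pos (by positivity)
  have hd1 : d ≤ 1 := min_le_left _ _
  have hev : ∀ i, 1 ≤ i → i ≤ 3 → ∀ᶠ t in atTop, ‖iteratedDeriv i w t‖ ≤ d ^ 3 := by
    intro i hi1 hi3
    have := (tendsto_zero_iff_norm_tendsto_zero.mp (h0 i hi1 hi3))
    exact (tendsto_order.1 this).2 _ (by positivity) |>.mono fun t ht ↦ ht.le
  obtain ⟨T, hT⟩ := eventually_atTop.1 ((hev 1 le_rfl (by norm_num)).and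
    ((hev 2 (by norm_num) (by norm_num)).and (hev 3 (by norm_num) le_rfl)))
  refine ⟨T, fun t ht ↦ ?_⟩
  obtain ⟨h1, h2, h3⟩ := hT t ht
  have hdi : ∀ i, 1 ≤ i → i ≤ 3 → ‖iteratedDeriv i w t‖ ≤ d ^ i := by
    intro i hi1 hi3
    have hle : d ^ 3 ≤ d ^ i := pow_le_pow_of_le_one hd0.le hd1 hi3
    interval_cases i
    · exact h1.trans hle
    · exact h2.trans hle
    · exact h3.trans hle
  have hb := hC w t d hw hw1 hwC hd0.le hd1 hdi l hl1 hl3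
  rw [dist_zero_right]
  calc ‖iteratedDeriv l (fun s ↦ ((w s) 0)⁻¹ • E4.spatial (w s)) t‖ ≤ C * d := hb
    _ ≤ C * (ε / (C + 1)) := mul_le_mul_of_nonneg_left (min_le_right _ _) hC0
    _ < ε := by
        rw [mul_div_assoc', div_lt_iff₀ (by positivity)]
        nlinarith

/-- **Second and third derivatives of the painted centre vanish** when the mismatch `ξ̇ − v` and
its first two derivatives, and `v′`, `v″`, tend to `0` (`ξ⁽²⁾ = (ξ̇ − v)′ + v′`,
`ξ⁽³⁾ = (ξ̇ − v)″ + v″`). [folklore] -/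
theorem tendsto_iteratedDeriv_centre {ξ v : ℝ → E3} (hξ : ContDiff ℝ ∞ ξ) (hv : ContDiff ℝ ∞ v)
    (hm : ∀ m : ℕ, m ≤ 2 → Tendsto (fun t ↦ iteratedDeriv m (fun s ↦ deriv ξ s - v s) t) atTop (𝓝 0))
    (hv0 : ∀ l, 1 ≤ l → l ≤ 2 → Tendsto (fun t ↦ iteratedDeriv l v t) atTop (𝓝 0)) :
    ∀ l, 2 ≤ l → l ≤ 3 → Tendsto (fun t ↦ iteratedDeriv l ξ t) atTop (𝓝 0) := by
  have hξ' : ContDiff ℝ ∞ (deriv ξ) := hξ.deriv'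
  have hmf : ContDiff ℝ ∞ (fun s ↦ deriv ξ s - v s) := hξ'.sub hv
  have hsum : deriv ξ = (fun s ↦ deriv ξ s - v s) + v := by funext s; simp
  have hkey : ∀ (k : ℕ) (t : ℝ), iteratedDeriv (k + 1) ξ t =
      iteratedDeriv k (fun s ↦ deriv ξ s - v s) t + iteratedDeriv k v t := by
    intro k t
    rw [iteratedDeriv_succ']
    conv_lhs => rw [hsum]
    exact iteratedDeriv_add (hmf.contDiffAt.of_le (by exact_mod_cast le_top))
      (hv.contDiffAt.of_le (by exact_mod_cast le_top))
  intro l hl2 hl3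
  obtain ⟨k, rfl⟩ : ∃ k, l = k + 1 := ⟨l - 1, by omega⟩
  have h1 := hm k (by omega)
  have h2 := hv0 k (by omega) (by omega)
  have h3 := h1.add h2
  rw [add_zero] at h3
  exact h3.congr fun t ↦ (hkey k t).symm

/-- A function with a limit at `+∞` is eventually bounded in norm by `‖limit‖ + 1`. [folklore] -/
theorem eventually_norm_le_of_tendsto {E : Type*} [NormedAddCommGroup E] {f : ℝ → E} {a : E}
    (h : Tendsto f atTop (𝓝 a)) : ∀ᶠ t in atTop, ‖f t‖ ≤ ‖a‖ + 1 := by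
  have := (Metric.tendsto_nhds.mp h) 1 one_pos
  filter_upwards [this] with t ht
  rw [dist_eq_norm] at ht
  linarith [norm_le_norm_add_norm_sub' (f t) a, norm_sub_rev (f t) a]

/-- Registered one-line form (stub `eventually_norm_le_of_tendsto_rechart` of the crux item) of
`eventually_norm_le_of_tendsto`. [folklore] -/
theorem eventually_norm_le_of_tendsto_rechart : open Filter Topology in ∀ {E : Type*} [NormedAddCommGroup E] {f : ℝ → E} {a : E}, Tendsto f atTop (𝓝 a) → ∀ᶠ t in atTop, ‖f t‖ ≤ ‖a‖ + 1 :=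
  fun h ↦ eventually_norm_le_of_tendsto h

end Summit.FinalStateConjecture.FinalStateConjecture.Theorems

end
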